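import Summits.Ventures.HodgeRepro2.T5SU11ResolventDerivativeGroundState
import Summits.Ventures.HodgeRepro2.T5SU11ResolventDerivativeMu
import Summits.Ventures.HodgeRepro2.T5SU11WeightedSpaceGroundStateODE
import Summits.Ventures.HodgeRepro2.T5SU11ResolventL2ContinuityAll
import Summits.Ventures.HodgeRepro2.T5SU11WeightedSpaceGroundStateOrder

/-!
# Summary XVIII — the resolvent on the ground-state weighted space `W_1`: analyticity in the spectral parameter, the
differential equation, uniqueness, the maximum principle, the order structure; `L²` continuity in `λ` (rows 561–565),
under uniform names

Throughout `μ = λ(λ − 2)`, `Ξ = φ_1` the ground state, `W_1 = {g continuous on (0, ∞) : |g| ≤ D Ξ}`.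

* `resolvent_continuous_lam`, `resolvent_hasDerivAt_lam`, `resolvent_deriv_lam` — **`λ ↦ G^I_λ g(t)` is continuous and
  differentiable on `(1, ∞)` with derivative `(2λ − 2) · G^I_λ(G^I_λ g)(t)`** (row 561);
* `resolvent_hasDerivAt_mu` — **`d/dμ (L − μ)⁻¹ g = (L − μ)⁻² g`** in the variable `μ`, `λ = 1 + √(μ + 1)` (row 562);
* `resolvent_hasDerivAt`, `resolvent_hasDerivAt'`, `resolvent_ode`, `resolvent_decay`, `resolvent_unique`,
  `resolvent_neg_of_nonneg` — **`u = G^I_λ g` is `C²`, solves `(L − μ) u = g`, is `o(φ_λ)`, is the unique such solution,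
  and the strong maximum principle** (row 563);
* `l2_continuous_lam` — **`λ ↦ G^I_λ g` is continuous into `L²(sinh 2t dt)` for every square-integrable source of the
  class** (row 564);
* `resolvent_neg_source`, `resolvent_const_mul_source`, `resolvent_antitone`, `abs_resolvent_le_neg_resolvent_abs`,
  `resolvent_mono_lam`, `resolvent_iterate_sign` — **linearity, the comparison principle, `|G^I_λ g| ≤ −G^I_λ |g|`,
  monotonicity in `λ`, alternating iterates** (row 565).

Nothing is claimed about (N).

Blind lane: Mathlib + the HodgeRepro2 prefix only; no sorry; axioms ⊆ {propext, Classical.choice,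
Quot.sound}.
-/

namespace Summit.Ventures.HodgeRepro2.T5SU11RadialSummaryXVIII

open Filter Topology MeasureTheory
open Set (Ioi Ioc)
open T5SU11Cartan T5SU11SphericalFunction T5SU11SphericalDecay T5SU11RadialGreenImproper
  T5SU11ResolventDerivativeGroundState T5SU11ResolventDerivativeMu T5SU11WeightedSpaceGroundStateODE
  T5SU11ResolventL2ContinuityAll T5SU11WeightedSpaceGroundStateOrder

/-- **`G^I(−g) = −G^I g`** (row 565). -/
theorem resolvent_neg_source (φ χ g : ℝ → ℝ) (t : ℝ) :
    greenSolI φ χ (fun s => -g s) t = -greenSolI φ χ g t :=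
  greenSolI_neg_source φ χ g t

/-- **`G^I(c g) = c G^I g`** (row 565). -/
theorem resolvent_const_mul_source (φ χ g : ℝ → ℝ) (c t : ℝ) :
    greenSolI φ χ (fun s => c * g s) t = c * greenSolI φ χ g t :=
  greenSolI_const_mul_source φ χ g c t

section measure

variable [MeasurableSpace Circle] [BorelSpace Circle]

variable {lam : ℝ} (hlam : 1 < lam) {g : ℝ → ℝ} (hg : ContinuousOn g (Ioi 0))
  {D : ℝ} (hD : ∀ s, 0 < s → |g s| ≤ D * sph 1 (hyp s))

include hlam hg hD in
/-- **`λ ↦ G^I_λ g(t)` is continuous at every `λ > 1`** on `W_1` (row 561). -/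
theorem resolvent_continuous_lam {t : ℝ} (ht : 0 < t) :
    Tendsto (fun l => greenSolI (fun t => sph l (hyp t)) (sphDecay l) g t) (𝓝 lam)
      (𝓝 (greenSolI (fun t => sph lam (hyp t)) (sphDecay lam) g t)) :=
  tendsto_greenSolI_lam hlam hg hD ht

include hlam hg hD in
/-- **The derivative of the resolvent in `λ`** on `W_1`: `(2λ − 2) · G^I_λ(G^I_λ g)(t)` (row 561). -/
theorem resolvent_hasDerivAt_lam {t : ℝ} (ht : 0 < t) :
    HasDerivAt (fun l => greenSolI (fun t => sph l (hyp t)) (sphDecay l) g t)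
      ((2 * lam - 2) * greenSolI (fun t => sph lam (hyp t)) (sphDecay lam)
        (greenSolI (fun t => sph lam (hyp t)) (sphDecay lam) g) t) lam :=
  hasDerivAt_greenSolI_lam hlam hg hD ht

include hlam hg hD in
/-- `deriv (λ ↦ G^I_λ g(t)) λ = (2λ − 2) · G^I_λ(G^I_λ g)(t)` on `W_1` (row 561). -/
theorem resolvent_deriv_lam {t : ℝ} (ht : 0 < t) :
    deriv (fun l => greenSolI (fun t => sph l (hyp t)) (sphDecay l) g t) lam
      = (2 * lam - 2) * greenSolI (fun t => sph lam (hyp t)) (sphDecay lam)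
        (greenSolI (fun t => sph lam (hyp t)) (sphDecay lam) g) t :=
  deriv_greenSolI_lam hlam hg hD ht

include hlam hg hD in
/-- **`d/dμ (L − μ)⁻¹ g = (L − μ)⁻² g`** on `W_1`, `λ = 1 + √(μ + 1)` (row 562). -/
theorem resolvent_hasDerivAt_mu {t : ℝ} (ht : 0 < t) :
    HasDerivAt (fun μ => greenSolI (fun t => sph (1 + Real.sqrt (μ + 1)) (hyp t)) (sphDecay (1 + Real.sqrt (μ + 1))) g t)
      (greenSolI (fun t => sph lam (hyp t)) (sphDecay lam) (greenSolI (fun t => sph lam (hyp t)) (sphDecay lam) g) t)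
      (lam * (lam - 2)) :=
  hasDerivAt_resolvent_mu hlam hg hD ht

include hlam hg hD in
/-- **`u = G^I_λ g` is differentiable** on `(0, ∞)` (row 563). -/
theorem resolvent_hasDerivAt {t : ℝ} (ht : 0 < t) :
    HasDerivAt (greenSolI (fun t => sph lam (hyp t)) (sphDecay lam) g)
      (greenSolI' (deriv fun t => sph lam (hyp t)) (sphDecay' lam) (fun t => sph lam (hyp t)) (sphDecay lam) g t) t :=
  hasDerivAt_greenSolI_ground hlam hg hD ht

include hlam hg hD in
/-- **`u′` is differentiable** on `(0, ∞)` (row 563). -/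
theorem resolvent_hasDerivAt' {t : ℝ} (ht : 0 < t) :
    HasDerivAt (greenSolI' (deriv fun t => sph lam (hyp t)) (sphDecay' lam) (fun t => sph lam (hyp t)) (sphDecay lam) g)
      (greenSolI'' (deriv (deriv fun t => sph lam (hyp t))) (sphDecay'' lam) (deriv fun t => sph lam (hyp t))
        (sphDecay' lam) (fun t => sph lam (hyp t)) (sphDecay lam) g t) t :=
  hasDerivAt_greenSolI'_ground hlam hg hD ht

include hlam in
/-- **`(L − μ) u = g`** for `u = G^I_λ g` (row 563). -/
theorem resolvent_ode {t : ℝ} (ht : 0 < t) :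
    Real.sinh (2 * t) * greenSolI'' (deriv (deriv fun t => sph lam (hyp t))) (sphDecay'' lam)
        (deriv fun t => sph lam (hyp t)) (sphDecay' lam) (fun t => sph lam (hyp t)) (sphDecay lam) g t
      + 2 * Real.cosh (2 * t) * greenSolI' (deriv fun t => sph lam (hyp t)) (sphDecay' lam)
        (fun t => sph lam (hyp t)) (sphDecay lam) g t
      = lam * (lam - 2) * Real.sinh (2 * t) * greenSolI (fun t => sph lam (hyp t)) (sphDecay lam) g t
        + Real.sinh (2 * t) * g t :=
  greenSolI_ode_ground hlam (g := g) ht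

include hlam hg hD in
/-- **`u/φ_λ → 0` at infinity** (row 563). -/
theorem resolvent_decay :
    Tendsto (fun t => greenSolI (fun t => sph lam (hyp t)) (sphDecay lam) g t / sph lam (hyp t)) atTop (𝓝 0) :=
  tendsto_greenSolI_div_sph_ground hlam hg hD

include hlam hg hD in
/-- **Uniqueness** of the bounded `o(φ_λ)` solution of `(L − μ) v = g` (row 563). -/
theorem resolvent_unique {v v' v'' : ℝ → ℝ}
    (hv : ∀ t, 0 < t → HasDerivAt v (v' t) t) (hv' : ∀ t, 0 < t → HasDerivAt v' (v'' t) t)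
    (hvode : ∀ t, 0 < t → Real.sinh (2 * t) * v'' t + 2 * Real.cosh (2 * t) * v' t
      = lam * (lam - 2) * Real.sinh (2 * t) * v t + Real.sinh (2 * t) * g t)
    {B : ℝ} (hB : ∀ᶠ t in 𝓝[>] (0 : ℝ), |v t| ≤ B)
    (hdecay : Tendsto (fun t => v t / sph lam (hyp t)) atTop (𝓝 0)) {t : ℝ} (ht : 0 < t) :
    v t = greenSolI (fun t => sph lam (hyp t)) (sphDecay lam) g t :=
  eq_greenSolI_of_ode_ground hlam hg hD hv hv' hvode hB hdecay ht

include hlam hg hD in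
/-- **The strong maximum principle** on `W_1` (row 563). -/
theorem resolvent_neg_of_nonneg (hg0 : ∀ s, 0 < s → 0 ≤ g s) {t₀ : ℝ} (ht₀ : 0 < t₀) (hgt₀ : 0 < g t₀)
    {t : ℝ} (ht : 0 < t) : greenSolI (fun t => sph lam (hyp t)) (sphDecay lam) g t < 0 :=
  greenSolI_neg_ground hlam hg hD hg0 ht₀ hgt₀ ht

include hlam hg in
/-- **`λ ↦ G^I_λ g` is continuous into `L²(sinh 2t dt)`** for every square-integrable source of the class (row 564). -/
theorem l2_continuous_lam {M : ℝ} (hM : ∀ s ∈ Ioc (0 : ℝ) 1, |g s| ≤ M) (hM0 : 0 ≤ M)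
    {ε C s₀ : ℝ} (hε : 2 - lam < ε) (hC : ∀ s, s₀ ≤ s → |g s| ≤ C * Real.exp (-ε * s))
    (hg2 : IntegrableOn (fun s => Real.sinh (2 * s) * g s ^ 2) (Ioi 0)) :
    Tendsto (fun l => ∫ t in Ioi 0, Real.sinh (2 * t) * (greenSolI (fun t => sph l (hyp t)) (sphDecay l) g t
        - greenSolI (fun t => sph lam (hyp t)) (sphDecay lam) g t) ^ 2) (𝓝 lam) (𝓝 0) :=
  tendsto_integral_sinh_mul_sub_sq_all hlam hg hM hM0 hε hC hg2

include hlam in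
/-- **The comparison principle on `W_1`** (row 565). -/
theorem resolvent_antitone {g₁ g₂ : ℝ → ℝ} (hg₁ : ContinuousOn g₁ (Ioi 0)) (hg₂ : ContinuousOn g₂ (Ioi 0))
    {D₁ D₂ : ℝ} (hD₁ : ∀ s, 0 < s → |g₁ s| ≤ D₁ * sph 1 (hyp s)) (hD₂ : ∀ s, 0 < s → |g₂ s| ≤ D₂ * sph 1 (hyp s))
    (hle : ∀ s, 0 < s → g₁ s ≤ g₂ s) {t : ℝ} (ht : 0 < t) :
    greenSolI (fun t => sph lam (hyp t)) (sphDecay lam) g₂ t ≤ greenSolI (fun t => sph lam (hyp t)) (sphDecay lam) g₁ t :=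
  greenSolI_antitone_ground hlam hg₁ hg₂ hD₁ hD₂ hle ht

include hlam hg hD in
/-- **`|G^I_λ g| ≤ −G^I_λ |g|`** on `W_1` (row 565). -/
theorem abs_resolvent_le_neg_resolvent_abs {t : ℝ} (ht : 0 < t) :
    |greenSolI (fun t => sph lam (hyp t)) (sphDecay lam) g t|
      ≤ -greenSolI (fun t => sph lam (hyp t)) (sphDecay lam) (fun s => |g s|) t :=
  abs_greenSolI_le_neg_greenSolI_abs_ground hlam hg hD ht

include hlam hg hD in
/-- **Monotonicity in the spectral parameter** on `W_1`: `g ≥ 0`, `1 < λ₂ ≤ λ` ⇒ `G^I_{λ₂} g ≤ G^I_λ g ≤ 0` (row 565). -/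
theorem resolvent_mono_lam {lam₂ : ℝ} (hlam₂ : 1 < lam₂) (hle : lam₂ ≤ lam) (hg0 : ∀ s, 0 < s → 0 ≤ g s)
    {t : ℝ} (ht : 0 < t) :
    greenSolI (fun t => sph lam₂ (hyp t)) (sphDecay lam₂) g t ≤ greenSolI (fun t => sph lam (hyp t)) (sphDecay lam) g t ∧
      greenSolI (fun t => sph lam (hyp t)) (sphDecay lam) g t ≤ 0 :=
  greenSolI_mono_lam_ground hlam hlam₂ hle hg hD hg0 ht

include hlam in
/-- **The iterates of a non-negative source alternate in sign** (row 565). -/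
theorem resolvent_iterate_sign (hg0 : ∀ s, 0 < s → 0 ≤ g s) (n : ℕ) {t : ℝ} (ht : 0 < t) :
    0 ≤ (-1 : ℝ) ^ n * ((greenSolI (fun t => sph lam (hyp t)) (sphDecay lam))^[n] g) t :=
  iterate_sign_ground hlam hg0 n ht

end measure

end Summit.Ventures.HodgeRepro2.T5SU11RadialSummaryXVIII
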